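import Mathlib
import Summits.Ventures.PercRepro2.KPrimeRootLeafCycle
import Summits.Ventures.PercRepro2.KPrimeRootLeafA1Cycle5
import Summits.Ventures.PercRepro2.CycleNecklace

/-!
# `(K′)` on every necklace with a root on a leaf (blind cell PercRepro2, mine-c g42;
`conjectures/MINE-C.md` §51.4)

For a necklace (`IsNecklace`) with the root `a₂` (resp. `a₁`) hung on a leaf at its mark `q kz`,
`(K′)` holds for every admissible weight vector whose leaf weight is `≠ 1`
(`kprime_necklace_rootLeaf_a₂`, `kprime_necklace_rootLeaf_a₁`): the block pattern carries the mass
vectors to `C₅` at the block weights (`conn_marks_iff_nk`, `prob_nkOpen_preimage`), the rotation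
puts the `z`-instance's `a₁` at `0`, and the dispatch lemmas supply the certificates — as for the
cycles in `KPrimeRootLeafCycle.lean`.
-/

namespace Summit.Ventures.PercRepro2

namespace KPrimeCycle

open Cycle

section Necklace

variable {V : Type*} {E : Type*} [Fintype E] [DecidableEq E] [Fintype V] [DecidableEq V]
variable {ends : E → Sym2 V} {q : Fin 5 → V} {blk : E → Fin 5} {Vj : Fin 5 → Set V}
variable {R : Type*} [Field R] [LinearOrder R] [IsStrictOrderedRing R]

omit [Fintype V] in
/-- **`(K′)` on a necklace with the root `a₂` hung on a leaf at the mark `q kz`**, for every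
placement of the labels `a₁, z, b, v, y` on the five marks and every admissible weight vector with
the leaf weight `≠ 1`. -/
theorem kprime_necklace_rootLeaf_a₂ (hN : IsNecklace ends q blk Vj) (p : E ⊕ Unit → R)
    (hp : IsProbVec p) (he : p (Sum.inr ()) ≠ 1) (k₁ kz kb kv ky : Fin 5) (h1z : k₁ ≠ kz)
    (h1b : k₁ ≠ kb) (h1v : k₁ ≠ kv) (h1y : k₁ ≠ ky) (hzb : kz ≠ kb) (hzv : kz ≠ kv)
    (hzy : kz ≠ ky) (hbv : kb ≠ kv) (hby : kb ≠ ky) (hvy : kv ≠ ky) :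
    KPrime.KPrimeHolds (leafExt ends (q kz)) (Sum.inl (q k₁)) (Sum.inr ()) (Sum.inl (q kb))
      (Sum.inl (q kv)) (Sum.inl (q ky)) p := by
  set w : E → R := p ∘ Sum.inl with hw
  have hwp : IsProbVec w := ⟨fun e => hp.nonneg _, fun e => hp.le_one _⟩
  set w' : Fin 5 → R := nkProb ends q blk w with hw'
  have hw'p : IsProbVec w' := isProbVec_nkProb hwp
  have hP : ∀ A : Set (Config (Fin 5)), prob w' A = prob w ((fun ω => nkOpen ends q blk ω) ⁻¹' A) :=
    fun A => (prob_nkOpen_preimage w A).symm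
  have hH : ∀ (ω : Config E) (x x' : Fin 5),
      Conn (cycN 5) ((fun ω => nkOpen ends q blk ω) ω) x x' ↔ Conn ends ω (q x) (q x') :=
    fun ω x x' => (conn_marks_iff_nk hN ω x x').symm
  have hT := kmasses_transport' hP hH k₁ kz kb kv ky
  have hI := isoMasses_transport' hP hH k₁ kb kv ky
  set w'' : Fin 5 → R := w' ∘ shiftEquiv k₁ with hw''
  have hw''p : IsProbVec w'' := ⟨fun i => hw'p.nonneg _, fun i => hw'p.le_one _⟩
  have e0z : (0 : Fin 5) ≠ kz - k₁ := fun h => h1z (sub_eq_zero.1 h.symm).symm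
  have e0b : (0 : Fin 5) ≠ kb - k₁ := fun h => h1b (sub_eq_zero.1 h.symm).symm
  have e0v : (0 : Fin 5) ≠ kv - k₁ := fun h => h1v (sub_eq_zero.1 h.symm).symm
  have e0y : (0 : Fin 5) ≠ ky - k₁ := fun h => h1y (sub_eq_zero.1 h.symm).symm
  have ezb : kz - k₁ ≠ kb - k₁ := fun h => hzb (sub_left_injective h)
  have ezv : kz - k₁ ≠ kv - k₁ := fun h => hzv (sub_left_injective h)
  have ezy : kz - k₁ ≠ ky - k₁ := fun h => hzy (sub_left_injective h)
  have ebv : kb - k₁ ≠ kv - k₁ := fun h => hbv (sub_left_injective h)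
  have eby : kb - k₁ ≠ ky - k₁ := fun h => hby (sub_left_injective h)
  have evy : kv - k₁ ≠ ky - k₁ := fun h => hvy (sub_left_injective h)
  refine kprime_leafExt_a₂ ends (q kz) (q k₁) (q kb) (q kv) (q ky) p hp he ?_ ?_ ?_
    (kprime_necklace hN w hwp k₁ kz kb kv ky h1z h1b h1v h1y hzb hzv hzy hbv hby hvy)
  · rw [← hI, isoMasses_shift5 w' k₁, sub_self]
    exact rootLeafF0_cycle5_zero w'' hw''p _ _ _ _ e0z e0b e0v e0y ezb ezv ezy ebv eby evy
  · rw [← hI, ← hT, isoMasses_shift5 w' k₁, kmasses_shift5 w' k₁, sub_self]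
    exact rootLeafG1_cycle5_zero w'' hw''p _ _ _ _ e0z e0b e0v e0y ezb ezv ezy ebv eby evy
  · rw [← hI, ← hT, isoMasses_shift5 w' k₁, kmasses_shift5 w' k₁, sub_self]
    exact rootLeafG2_cycle5_zero w'' hw''p _ _ _ _ e0z e0b e0v e0y ezb ezv ezy ebv eby evy

omit [Fintype V] in
/-- **`(K′)` on a necklace with the root `a₁` hung on a leaf at the mark `q kz`**, for every
placement of the labels `z, a₂, b, v, y` on the five marks and every admissible weight vector with
the leaf weight `≠ 1`. -/
theorem kprime_necklace_rootLeaf_a₁ (hN : IsNecklace ends q blk Vj) (p : E ⊕ Unit → R)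
    (hp : IsProbVec p) (he : p (Sum.inr ()) ≠ 1) (kz k₂ kb kv ky : Fin 5) (hz2 : kz ≠ k₂)
    (hzb : kz ≠ kb) (hzv : kz ≠ kv) (hzy : kz ≠ ky) (h2b : k₂ ≠ kb) (h2v : k₂ ≠ kv)
    (h2y : k₂ ≠ ky) (hbv : kb ≠ kv) (hby : kb ≠ ky) (hvy : kv ≠ ky) :
    KPrime.KPrimeHolds (leafExt ends (q kz)) (Sum.inr ()) (Sum.inl (q k₂)) (Sum.inl (q kb))
      (Sum.inl (q kv)) (Sum.inl (q ky)) p := by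
  set w : E → R := p ∘ Sum.inl with hw
  have hwp : IsProbVec w := ⟨fun e => hp.nonneg _, fun e => hp.le_one _⟩
  set w' : Fin 5 → R := nkProb ends q blk w with hw'
  have hw'p : IsProbVec w' := isProbVec_nkProb hwp
  have hP : ∀ A : Set (Config (Fin 5)), prob w' A = prob w ((fun ω => nkOpen ends q blk ω) ⁻¹' A) :=
    fun A => (prob_nkOpen_preimage w A).symm
  have hH : ∀ (ω : Config E) (x x' : Fin 5),
      Conn (cycN 5) ((fun ω => nkOpen ends q blk ω) ω) x x' ↔ Conn ends ω (q x) (q x') :=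
    fun ω x x' => (conn_marks_iff_nk hN ω x x').symm
  have hT := kmasses_transport' hP hH kz k₂ kb kv ky
  have hI := isoMassesA₁_transport' hP hH k₂ kv ky
  set w'' : Fin 5 → R := w' ∘ shiftEquiv kz with hw''
  have hw''p : IsProbVec w'' := ⟨fun i => hw'p.nonneg _, fun i => hw'p.le_one _⟩
  have e02 : (0 : Fin 5) ≠ k₂ - kz := fun h => hz2 (sub_eq_zero.1 h.symm).symm
  have e0b : (0 : Fin 5) ≠ kb - kz := fun h => hzb (sub_eq_zero.1 h.symm).symm
  have e0v : (0 : Fin 5) ≠ kv - kz := fun h => hzv (sub_eq_zero.1 h.symm).symm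
  have e0y : (0 : Fin 5) ≠ ky - kz := fun h => hzy (sub_eq_zero.1 h.symm).symm
  have e2b : k₂ - kz ≠ kb - kz := fun h => h2b (sub_left_injective h)
  have e2v : k₂ - kz ≠ kv - kz := fun h => h2v (sub_left_injective h)
  have e2y : k₂ - kz ≠ ky - kz := fun h => h2y (sub_left_injective h)
  have ebv : kb - kz ≠ kv - kz := fun h => hbv (sub_left_injective h)
  have eby : kb - kz ≠ ky - kz := fun h => hby (sub_left_injective h)
  have evy : kv - kz ≠ ky - kz := fun h => hvy (sub_left_injective h)
  refine kprime_leafExt_a₁ ends (q kz) (q k₂) (q kb) (q kv) (q ky) p hp he ?_ ?_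
    (kprime_necklace hN w hwp kz k₂ kb kv ky hz2 hzb hzv hzy h2b h2v h2y hbv hby hvy)
  · rw [← hI, ← hT, isoMassesA₁_shift5 w' kz, kmasses_shift5 w' kz, sub_self]
    exact rootLeafA1G1_cycle5_zero w'' hw''p _ _ _ _ e02 e0b e0v e0y e2b e2v e2y ebv eby evy
  · rw [← hI, ← hT, isoMassesA₁_shift5 w' kz, kmasses_shift5 w' kz, sub_self]
    exact rootLeafA1G2_cycle5_zero w'' hw''p _ _ _ _ e02 e0b e0v e0y e2b e2v e2y ebv eby evy

end Necklace

end KPrimeCycle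

end Summit.Ventures.PercRepro2
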